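import Mathlib.MeasureTheory.Integral.Prod
import Mathlib.MeasureTheory.Group.Measure
import HarnessLib

/-!
# Dropping the compact variable in the Iwasawa-coordinate orbital integral of a `K`-conjugation
# invariant test function: `∫_{K×N} ψ(k (t n) k⁻¹) = vol(K) · ∫_N ψ(t n)`

R90-TF, section S6 (Rogawski Ch. 14.1–14.5, stable trace formula), card **W7-h** (DAG rows E1.3.3.1 ∕
E1.3.3.2: local Iwasawa–Haar integration and the van Dijk ∕ Harish-Chandra lemma at a split-regular
`t`), helper lane for `stmt-HodgeConjecture-24833`; statements = W7-h TARGET SHEET v1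
(`R90/R90-C14-typ1/g2/S6_wave7h_targets.v1.lean`, sha16 8394c20cc36da7a9) VERBATIM.

The tree's ★ canonical orbital-integral theorems in Iwasawa coordinates
(`Literature.NumberTheory.Automorphic.UnitaryGroup.classOrbitalIntegral_eq_smul_integral_prod_of_torus_regular`
for `U(Φ₃)(L⁺_v)`, `…_two` for `U(Φ₂)`, `…_of_nonsplit` on `H_v`, and the `GL_n` twin
`GLnLeviOrbitalDescent`) end in `… • ∫ p : ↥K × ↥N, φ (e (↑p.1 * (↑t * ↑p.2) * (↑p.1)⁻¹)) ∂(κ.prod μN)`.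
For a test function which is invariant under conjugation by `K` (e.g. a BI-`K`-invariant Hecke
function) the `K`-integral drops and one is left with van Dijk's constant-term shape
`vol(K) · ∫_N φ(t n) dn` ([vanDijk1972] p. 237; [Rogawski1990] §4.3 p. 48, §4.9 (4.9.1)). This file
types that one generic step, for an arbitrary group `G` with subgroups `K`, `N` and measures given as
binders (no Haar hypothesis is needed):

* `integral_prod_conj_eq_smul_integral_of_conj_invariant` (W7-h.1a, Bochner, guard-free):
  `∫ (k, n), ψ (k (t n) k⁻¹) d(κ ⊗ μN) = κ.real univ • ∫ n, ψ (t n) dμN` — after the pointwise rewrite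
  by invariance the integrand depends on the `N`-variable only, and Mathlib's `integral_fun_snd` is
  hypothesis-free (both sides are junk `0` together; for `κ univ = ∞` the right side reads `0 • _`
  and so does the left, by the same lemma).
* `lintegral_prod_conj_eq_mul_lintegral_of_conj_invariant` (W7-h.1b, `ℝ≥0∞` twin, Tonelli
  `lintegral_prod` + `lintegral_const`; needs `Measurable ψ` and `[MeasurableMul G]`).
* `conj_invariant_comp_of_biInvariant` (W7-h.1c, the invariance feed): a bi-`K'`-invariant `φ` on
  `G'` read through `e : G ≃* G'` with `e(K) ⊆ K'` is conjugation-`K`-invariant.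

## References
* [vanDijk1972] G. van Dijk, *Computation of certain induced characters of 𝔭-adic groups*, Math.
  Ann. 199 (1972), 229–240, Thm. p. 237.
* [Rogawski1990] J. D. Rogawski, *Automorphic Representations of Unitary Groups in Three
  Variables*, Ann. of Math. Stud. 123 (1990), §4.3 p. 48, §4.9 (4.9.1)–(4.9.4) pp. 55–56.
-/

set_option autoImplicit false
set_option linter.dupNamespace false

namespace Summit.HodgeConjecture.HodgeConjecture.R90.S6

open MeasureTheory
open scoped ENNReal

section Integral

variable {G : Type*} [Group G] [MeasurableSpace G]

/-- **W7-h.1a — dropping the compact variable (Bochner form, guard-free).** For `ψ : G → E`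
invariant under conjugation by the subgroup `K` (`ψ (k x k⁻¹) = ψ x`), any s-finite measures `κ`
on `K` and `μN` on the subgroup `N`, and any `t : G`:
`∫ (k, n), ψ (k (t n) k⁻¹) d(κ ⊗ μN) = κ.real univ • ∫ n, ψ (t n) dμN`. No measurability or
integrability hypothesis: after rewriting by invariance the integrand is a function of the second
variable and `MeasureTheory.integral_fun_snd` applies unconditionally. This is the step by which the
`K`-integral disappears from the Iwasawa-coordinate orbital integral of a bi-`K`-invariant function
(van Dijk, Math. Ann. 199 (1972), p. 237; Rogawski 1990, §4.3 p. 48). -/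
theorem integral_prod_conj_eq_smul_integral_of_conj_invariant
    {E : Type*} [NormedAddCommGroup E] [NormedSpace ℝ E]
    (K N : Subgroup G) (κ : Measure ↥K) (μN : Measure ↥N) [SFinite κ] [SFinite μN]
    (t : G) {ψ : G → E} (hψ : ∀ k : ↥K, ∀ x : G, ψ ((k : G) * x * (k : G)⁻¹) = ψ x) :
    ∫ p : ↥K × ↥N, ψ ((p.1 : G) * (t * (p.2 : G)) * (p.1 : G)⁻¹) ∂(κ.prod μN) =
      κ.real Set.univ • ∫ n : ↥N, ψ (t * (n : G)) ∂μN := by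
  simp_rw [hψ]
  exact integral_fun_snd (fun n : ↥N => ψ (t * (n : G)))

/-- **W7-h.1b — dropping the compact variable (`ℝ≥0∞` form, Tonelli).** For a measurable
`ψ : G → ℝ≥0∞` invariant under conjugation by the subgroup `K`, any measure `κ` on `K`, any s-finite
measure `μN` on the subgroup `N`, and any `t : G` (with measurable left translations on `G`):
`∫⁻ (k, n), ψ (k (t n) k⁻¹) d(κ ⊗ μN) = κ univ * ∫⁻ n, ψ (t n) dμN` (Tonelli
`MeasureTheory.lintegral_prod` and `lintegral_const`). (van Dijk, Math. Ann. 199 (1972), p. 237;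
Rogawski 1990, §4.3 p. 48.) -/
theorem lintegral_prod_conj_eq_mul_lintegral_of_conj_invariant [MeasurableMul G]
    (K N : Subgroup G) (κ : Measure ↥K) (μN : Measure ↥N) [SFinite μN]
    (t : G) {ψ : G → ℝ≥0∞} (hψm : Measurable ψ) (hψ : ∀ k : ↥K, ∀ x : G, ψ ((k : G) * x * (k : G)⁻¹) = ψ x) :
    ∫⁻ p : ↥K × ↥N, ψ ((p.1 : G) * (t * (p.2 : G)) * (p.1 : G)⁻¹) ∂(κ.prod μN) =
      κ Set.univ * ∫⁻ n : ↥N, ψ (t * (n : G)) ∂μN := by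
  simp_rw [hψ]
  have hm : Measurable fun n : ↥N => ψ (t * (n : G)) :=
    hψm.comp ((measurable_const_mul t).comp measurable_subtype_coe)
  rw [lintegral_prod (fun p : ↥K × ↥N => ψ (t * (p.2 : G))) (hm.comp measurable_snd).aemeasurable]
  simp only [lintegral_const]
  rw [mul_comm]

end Integral

section Invariance

variable {G : Type*} [Group G]

/-- **W7-h.1c — the invariance feed.** A bi-`K'`-invariant function `φ` on `G'`
(`φ (x g y) = φ g` for `x, y ∈ K'`, the first conjunct of the tree's `mem_biInvariantFunctions_iff`),
read through a group isomorphism `e : G ≃* G'` carrying `K` into `K'`, is invariant under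
conjugation by `K`: `φ (e (k x k⁻¹)) = φ (e x)` — since `e (k x k⁻¹) = e k · e x · (e k)⁻¹` with
`e k, (e k)⁻¹ ∈ K'`. [folklore] -/
theorem conj_invariant_comp_of_biInvariant {G' : Type*} [Group G'] {E : Sort*}
    (e : G ≃* G') (K : Subgroup G) (K' : Subgroup G') (he : ∀ k : ↥K, e (k : G) ∈ K')
    {φ : G' → E} (hφ : ∀ x ∈ K', ∀ y ∈ K', ∀ g : G', φ (x * g * y) = φ g) :
    ∀ k : ↥K, ∀ x : G, φ (e ((k : G) * x * (k : G)⁻¹)) = φ (e x) := by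
  intro k x
  rw [map_mul, map_mul, map_inv]
  exact hφ _ (he k) _ (inv_mem (he k)) _

end Invariance

end Summit.HodgeConjecture.HodgeConjecture.R90.S6
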